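import Summits.AtomisticToContinuum.Crystallization.Theorems.FluxTubeKeplerFloorGivesLayered
import Summits.AtomisticToContinuum.Crystallization.Theorems.FluxTubeKeplerFluxCellKeplerSingleScale
import Summits.AtomisticToContinuum.Crystallization.Theorems.ChessboardParticlePlanesPeriodicWindowsIffCrystallization
import Summits.AtomisticToContinuum.Crystallization.Theorems.FluxTubeKeplerKeplerEnergyFloor

/-!
# Line `RegistryBlindRung` (registry ladder) — skeleton for the forward rung over `FluxTubeKepler.FloorGivesLayered`
(crux dir `FluxCellKepler`, stmt-AtomisticToContinuum-15221; fwd-rung G1 gen 4, seed g1-AtomisticToContinuum-15223)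

FLOOR (proved, `FluxTubeKeplerFloorGivesLayered.FloorGivesLayered_proof`): for every periodic `P₀`, the energy
floor `N·e(P₀) ≤ E(x)` on Lennard-Jones ground states together with the defect BUDGET — at every scale `(R,η)` some
`c > 0` prices every site whose `R`-neighbourhood is not two-way `η`-close to an admissible BARLOW-REGISTERED layered
template (triangular layers of spacing `a ∈ [47/50,1]`, Hägg word, heights in the box, each layer laterally at a
hollow site `(haggLabel s m)•barlowOffset a` of its neighbours) — forces layered windows, hence (proved
`PeriodicGivenLayered`) periodic windows, along every ground-state sequence.

RUNG (`RegistryBlindRung := RegRung 1`): the budget need only price the sites whose `R`-neighbourhood is not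
two-way `η`-close to a LAMINAR template — the same stack of triangular layers with the same height box but with
EVERY LAYER TRANSLATED LATERALLY AT WILL (`(o m).1 • u + (o m).2 • v`, `|o m|_∞ ≤ κ`; `κ = 1` reaches every
registry: bridge, on-top, incommensurate).  Dial `RegRung κ`: `RegRung 0` is the floor (`regRung_zero`, F3),
antitone dial `regRung_anti` (harder-to-easier = decreasing `κ`), on-path `regRung_of_crystallization` /
`RegistryBlindRung_of_Crystallization` (F4, landed iff `periodicWindows_of_crystallization`).

WHY THE FLOOR'S PROOF STOPS: Step 1 of the seed (`eventually_exists_not_bad`) now yields only LAMINAR-good sites;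
Steps 2–3 (`spacing_selection`, `match_dilate`) transport whatever template they are given, so they would produce
laminar, not Barlow, windows, and `PeriodicGivenLayered` has no input.  No potential-free repair exists: a periodic
stack with every layer in BRIDGE registry is laminar-good at every site and Barlow-good at none.  The missing
input is ENERGY: which registry a Lennard-Jones ground state selects.

THE LINE (three stubs, the only `sorry`s; composition `RegistryBlindRung_of` sorry-free):
* `stub_registryGap` (THE NEW INPUT, configuration-free real analysis on explicit lattice sums): the interlayer
  Lennard-Jones registry energy of a finite stack of triangular layers with heights in the box is COERCIVE about the
  Barlow registries — `F(z,c) ≥ F(z,c_reg) + κ₀·Σ_m dist(c_{m+1} − c_m, hollow set)²` for some registered `c_reg`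
  (adjacent-layer lattice sum uniquely minimised at the hollow sites with curvature `≥ 1.4` and bridge gap `≥ 0.017`;
  farther-layer registry couplings have Hessian `≤ 4·10⁻³` — Poisson/Bessel decay; hand numerics in the line card).
* `stub_misregistrySparse` (Lennard-Jones block accounting along ground states): under FLOOR + the laminar budget,
  `E(x_N) = N·e* + o(N)` (`floor_iff_eq_eStar`, `crysEnergyLimit`), every window of a registered box stack has layer
  energies summing to `≥ n·e* − C` (periodisation; `card_mul_eStar_le`), and the registry gap make the sites near a
  `d`-misregistered interface `o(N)`.
* `stub_barlowRounding` (potential-free geometry): a laminar template whose central interfaces are `d`-close to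
  hollow registry is, on the `2`-ball, `η`-close to a genuine Barlow template (round the Hägg signs, re-index).
Glue (proved here): monotonicity of the predicates, `sparse_bad_two`, `good_of_sparse` (landed chart gluing
`FluxCellKeplerSingleScale.card_bad_le` + `LennardJonesMinimalDistance_holds`), `hasLayeredWindows_of_good`
(Steps 2–3 of the seed, verbatim from the sibling lines `Lines/PosTolRung.lean` / `Lines/VacancyBlindRung.lean`),
proved `PeriodicGivenLayered`.
-/

noncomputable section

namespace Summit.AtomisticToContinuum.Crystallization.Cruxes.FluxCellKepler.RegistryLadder

open scoped BigOperators Classical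
open Filter Topology
open Literature.MathematicalPhysics.StatisticalMechanics
open Summit.AtomisticToContinuum.Crystallization.Theorems.FluxCellKeplerSingleScale
  (LayeredGood layeredGood_mono card_bad_le)

local notation "E3" => EuclideanSpace ℝ (Fin 3)

/-- FLOOR(P₀): `N · e(P₀) ≤ E(x)` for every Lennard-Jones ground state (verbatim the floor's first hypothesis). -/
def Floor (P₀ : PeriodicConfiguration 3) : Prop :=
  ∀ (N : ℕ) (x : Fin N → E3), IsGroundState lennardJones x →
    (N : ℝ) * P₀.energyPerParticle lennardJones ≤ interactionEnergy lennardJones x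

/-- `κ`-LAMINAR-GOOD SITE: some admissible layered template (spacing `a ∈ [47/50, 1]`, Hägg word `s`, heights in
the box, rigid motion `A`) whose layer `m` is moreover translated laterally by `(o m).1 • u + (o m).2 • v` with
`|(o m).1|, |(o m).2| ≤ κ`, matches the `R`-ball around `x i` two-way with tolerance `η`.  `κ = 0`: the floor's
Barlow-registered predicate `LayeredGood R η`; `κ = 1`: every registry (registry-blind). -/
def RegGood (κ R η : ℝ) {N : ℕ} (x : Fin N → E3) (i : Fin N) : Prop :=
  ∃ a : ℝ, 47 / 50 ≤ a ∧ a ≤ 1 ∧ ∃ (A : E3 →ₗᵢ[ℝ] E3) (s : ℤ → ℤ) (z : ℤ → ℝ) (o : ℤ → ℝ × ℝ), IsHaggSeq s ∧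
    (∀ m : ℤ, 39 / 50 * a ≤ z (m + 1) - z m ∧ z (m + 1) - z m ≤ 17 / 20 * a) ∧
    (∀ m : ℤ, |(o m).1| ≤ κ ∧ |(o m).2| ≤ κ) ∧
    let S : Set E3 := {p | ∃ m k l : ℤ, p = A (((k : ℝ) • triangularVec₁ a) + ((l : ℝ) • triangularVec₂ a) +
      ((haggLabel s m : ℝ) • barlowOffset a) + (((o m).1 • triangularVec₁ a) + ((o m).2 • triangularVec₂ a)) +
      (z m • layerNormal 1))}
    (∀ p ∈ S, ‖p‖ ≤ R → ∃ j : Fin N, dist (x j - x i) p ≤ η) ∧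
    (∀ j : Fin N, ‖x j - x i‖ ≤ R → ∃ p ∈ S, dist (x j - x i) p ≤ η)

/-- REGISTRY-BLIND BUDGET with dial `κ`: at every scale `(R,η)` some `c > 0` prices the sites that are not
`κ`-laminar-good against the excess energy over `N · e(P₀)` (`κ = 0`: the floor's budget). -/
def RegBudget (κ : ℝ) (P₀ : PeriodicConfiguration 3) : Prop :=
  ∀ R η : ℝ, 0 < R → 0 < η → ∃ c : ℝ, 0 < c ∧
    ∀ (N : ℕ) (x : Fin N → E3), IsGroundState lennardJones x →
      c * (Nat.card {i : Fin N // ¬ RegGood κ R η x i} : ℝ) ≤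
        interactionEnergy lennardJones x - (N : ℝ) * P₀.energyPerParticle lennardJones

/-- Periodic windows at every scale along `x` (verbatim the conclusion of `FluxTubeKepler.PeriodicGivenLayered`). -/
def HasPeriodicWindows (x : (N : ℕ) → (Fin N → E3)) : Prop :=
  ∃ P : PeriodicConfiguration 3, ∀ R ε : ℝ, 0 < ε → ∃ᶠ N in atTop, ∃ t : E3,
    (∀ s ∈ P.points, ‖s‖ ≤ R → ∃ i : Fin N, dist (x N i + t) s ≤ ε) ∧
    (∀ i : Fin N, ‖x N i + t‖ ≤ R → ∃ s ∈ P.points, dist (x N i + t) s ≤ ε)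

/-- **The graded family.** `RegRung κ`: FLOOR and the `κ`-registry-blind budget force periodic windows along
every Lennard-Jones ground-state sequence. -/
def RegRung (κ : ℝ) : Prop :=
  ∀ P₀ : PeriodicConfiguration 3, Floor P₀ → RegBudget κ P₀ →
    ∀ x : (N : ℕ) → (Fin N → E3), (∀ N, IsGroundState lennardJones (x N)) → HasPeriodicWindows x

/-- **Deciding rung.** The budget need not price STACKING REGISTRY at all: pricing only the sites whose
`R`-neighbourhood is not `η`-close to SOME stack of triangular layers (any lateral position of each layer, heights
in the box) suffices — the Barlow registry of the windows is then selected by the energy. -/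
def RegistryBlindRung : Prop := RegRung 1

/-! ## Predicate bookkeeping -/

theorem regGood_mono {κ κ' R η : ℝ} (hκ : κ ≤ κ') {N : ℕ} (x : Fin N → E3) (i : Fin N) :
    RegGood κ R η x i → RegGood κ' R η x i := by
  rintro ⟨a, ha₁, ha₂, A, s, z, o, hs, hz, ho, h₁, h₂⟩
  exact ⟨a, ha₁, ha₂, A, s, z, o, hs, hz, fun m => ⟨(ho m).1.trans hκ, (ho m).2.trans hκ⟩, h₁, h₂⟩

theorem layeredGood_of_regGood_zero {R η : ℝ} {N : ℕ} (x : Fin N → E3) (i : Fin N) :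
    RegGood 0 R η x i → LayeredGood R η x i := by
  rintro ⟨a, ha₁, ha₂, A, s, z, o, hs, hz, ho, h₁, h₂⟩
  have ho' : ∀ m : ℤ, (o m).1 = 0 ∧ (o m).2 = 0 := fun m =>
    ⟨abs_nonpos_iff.mp (ho m).1, abs_nonpos_iff.mp (ho m).2⟩
  refine ⟨a, ha₁, ha₂, A, s, z, hs, hz, ?_, ?_⟩
  · rintro p ⟨m, k, l, rfl⟩ hpR
    exact h₁ _ ⟨m, k, l, by simp [(ho' m).1, (ho' m).2]⟩ hpR
  · intro j hj
    obtain ⟨p, ⟨m, k, l, rfl⟩, hjp⟩ := h₂ j hj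
    exact ⟨_, ⟨m, k, l, rfl⟩, by simpa [(ho' m).1, (ho' m).2] using hjp⟩

theorem regGood_zero_of_layeredGood {R η : ℝ} {N : ℕ} (x : Fin N → E3) (i : Fin N) :
    LayeredGood R η x i → RegGood 0 R η x i := by
  rintro ⟨a, ha₁, ha₂, A, s, z, hs, hz, h₁, h₂⟩
  refine ⟨a, ha₁, ha₂, A, s, z, fun _ => ((0 : ℝ), (0 : ℝ)), hs, hz, fun m => ⟨by simp, by simp⟩, ?_, ?_⟩
  · rintro p ⟨m, k, l, rfl⟩ hpR
    exact h₁ _ ⟨m, k, l, by simp⟩ (by simpa using hpR)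
  · intro j hj
    obtain ⟨p, ⟨m, k, l, rfl⟩, hjp⟩ := h₂ j hj
    exact ⟨_, ⟨m, k, l, rfl⟩, by simpa using hjp⟩

/-- The budget is monotone in the dial: a budget pricing the larger bad set prices the smaller one. -/
theorem regBudget_mono {κ κ' : ℝ} (hκ : κ ≤ κ') (P₀ : PeriodicConfiguration 3) :
    RegBudget κ P₀ → RegBudget κ' P₀ := by
  intro hB R η hR hη
  obtain ⟨c, hc, hcB⟩ := hB R η hR hη
  refine ⟨c, hc, fun N x hx => le_trans ?_ (hcB N x hx)⟩
  have hle : Nat.card {i : Fin N // ¬ RegGood κ' R η x i} ≤ Nat.card {i : Fin N // ¬ RegGood κ R η x i} := by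
    rw [Nat.card_eq_fintype_card, Nat.card_eq_fintype_card]
    exact Fintype.card_subtype_mono _ _ fun i hi hg => hi (regGood_mono hκ x i hg)
  exact mul_le_mul_of_nonneg_left (by exact_mod_cast hle) hc.le

/-! ## F3 — the family specialises to the proved floor -/

/-- `RegRung 0` is the floor: the seed theorem followed by the proved `PeriodicGivenLayered`. -/
theorem regRung_zero : RegRung 0 := by
  intro P₀ hF hB x hx
  refine Theses.FluxTubeKepler.PeriodicGivenLayered_holds x hx
    (Theorems.FluxTubeKeplerFloorGivesLayered.FloorGivesLayered_proof P₀ hF ?_ x hx)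
  intro R η hR hη
  obtain ⟨c, hc, hcB⟩ := hB R η hR hη
  refine ⟨c, hc, fun N y hy => ?_⟩
  show c * (Nat.card {i : Fin N // ¬ LayeredGood R η y i} : ℝ) ≤ _
  refine le_trans ?_ (hcB N y hy)
  have hle : Nat.card {i : Fin N // ¬ LayeredGood R η y i} ≤ Nat.card {i : Fin N // ¬ RegGood 0 R η y i} := by
    rw [Nat.card_eq_fintype_card, Nat.card_eq_fintype_card]
    exact Fintype.card_subtype_mono _ _ fun i hi hg => hi (layeredGood_of_regGood_zero y i hg)
  exact mul_le_mul_of_nonneg_left (by exact_mod_cast hle) hc.le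

/-! ## Dial monotonicity (harder-to-easier = decreasing `κ`) -/

theorem regRung_anti {κ κ' : ℝ} (hκ : κ ≤ κ') : RegRung κ' → RegRung κ :=
  fun H P₀ hF hB x hx => H P₀ hF (regBudget_mono hκ P₀ hB) x hx

/-- The deciding rung gives every member below it, in particular the floor (informational `specialises`). -/
theorem regRung_of_registryBlindRung {κ : ℝ} (hκ : κ ≤ 1) (h : RegistryBlindRung) : RegRung κ :=
  regRung_anti hκ h

/-! ## F4 — on-path lemmas: the sub-problem implies every member -/

theorem regRung_of_crystallization (κ : ℝ) (h : _root_.Crystallization) : RegRung κ :=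
  fun _ _ _ x hx =>
    Theorems.ChessboardParticlePlanesPeriodicWindowsIffCrystallization.periodicWindows_of_crystallization h x hx

@[aesop safe apply]
theorem RegistryBlindRung_of_Crystallization (h : _root_.Crystallization) : RegistryBlindRung :=
  regRung_of_crystallization 1 h

/-! ## How the rung relieves the parent crux `FluxCellKepler` (documentation, sorry-free) -/

/-- The floor-and-registry-blind-budget package (what a Kepler-type certificate that never has to charge a site
for its STACKING REGISTRY delivers). -/
def RegKeplerFloor (κ : ℝ) : Prop := ∃ P₀ : PeriodicConfiguration 3, Floor P₀ ∧ RegBudget κ P₀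

theorem crystallization_of_regRung {κ : ℝ} (h : RegRung κ) (hK : RegKeplerFloor κ) :
    _root_.Crystallization := by
  obtain ⟨P₀, hF, hB⟩ := hK
  exact Theorems.ChessboardParticlePlanesPeriodicWindowsIffCrystallization.crystallization_of_periodicWindows
    (fun x hx => h P₀ hF hB x hx)

/-- The parent crux gives the package at `κ = 0` (proved `KeplerEnergyFloor` + minimal distance). -/
theorem regKeplerFloor_zero_of_fluxCellKepler (hK : Theses.FluxTubeKepler.FluxCellKepler) : RegKeplerFloor 0 := by
  obtain ⟨P₀, hF, hB⟩ := Theorems.keplerEnergyFloor_proof hK LennardJonesMinimalDistance_holds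
  refine ⟨P₀, hF, fun R η hR hη => ?_⟩
  obtain ⟨c, hc, hcB⟩ := hB R η hR hη
  refine ⟨c, hc, fun N y hy => ?_⟩
  have hcB' : c * (Nat.card {i : Fin N // ¬ LayeredGood R η y i} : ℝ) ≤
      interactionEnergy lennardJones y - (N : ℝ) * P₀.energyPerParticle lennardJones := hcB N y hy
  refine le_trans ?_ hcB'
  have hle : Nat.card {i : Fin N // ¬ RegGood 0 R η y i} ≤ Nat.card {i : Fin N // ¬ LayeredGood R η y i} := by
    rw [Nat.card_eq_fintype_card, Nat.card_eq_fintype_card]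
    exact Fintype.card_subtype_mono _ _ fun i hi hg => hi (regGood_zero_of_layeredGood y i hg)
  exact mul_le_mul_of_nonneg_left (by exact_mod_cast hle) hc.le


/-! ## The line: registry selection from energy

Coefficient conventions.  Lateral positions are written in the basis `u = triangularVec₁ a`, `v = triangularVec₂ a`
(`barlowOffset a = (u + v)/3`); the relative lateral shift of layer `m+1` over layer `m` of a `RegGood` template is,
in coefficients, `((s m)/3 + (o (m+1)).1 − (o m).1, (s m)/3 + (o (m+1)).2 − (o m).2)` (`haggLabel_succ`), and it is
a BARLOW (hollow-site) registry iff it lies in the hollow set `{(1/3,1/3), (2/3,2/3)} + ℤ²`. -/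

/-- The hollow set in lattice coefficients: relative shifts `±barlowOffset` modulo the triangular lattice. -/
def hollowSet : Set (ℝ × ℝ) :=
  {c | ∃ k l : ℤ, c = ((k : ℝ) + 1 / 3, (l : ℝ) + 1 / 3) ∨ c = ((k : ℝ) + 2 / 3, (l : ℝ) + 2 / 3)}

/-- Misregistry of a relative lateral shift `c` (coefficients, sup metric of `ℝ × ℝ`): distance to the hollow set. -/
def hollowDist (c : ℝ × ℝ) : ℝ := Metric.infDist c hollowSet

/-- Misregistry of the interface `(m, m+1)` of a `RegGood`-type template with Hägg word `s` and lateral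
perturbation `o`. -/
def misreg (s : ℤ → ℤ) (o : ℤ → ℝ × ℝ) (m : ℤ) : ℝ :=
  hollowDist ((s m : ℝ) / 3 + ((o (m + 1)).1 - (o m).1), (s m : ℝ) / 3 + ((o (m + 1)).2 - (o m).2))

/-- Interlayer Lennard-Jones registry coupling: the energy of one site at height `H` above a triangular layer of
spacing `a`, laterally displaced by `c.1 • u + c.2 • v` (lattice sum over the layer). -/
def interlayerSum (a H : ℝ) (c : ℝ × ℝ) : ℝ :=
  ∑' kl : ℤ × ℤ, lennardJones ‖(((kl.1 : ℝ) + c.1) • triangularVec₁ a) + ((((kl.2 : ℝ) + c.2)) • triangularVec₂ a) +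
    (H • layerNormal 1)‖

/-- Interlayer registry energy per column of a finite stack: layers `0, …, n` at heights `z m` with lateral
coefficients `c m`; sum over pairs of layers of the coupling at their height difference and relative shift. -/
def stackEnergy (a : ℝ) (n : ℕ) (z : ℕ → ℝ) (c : ℕ → ℝ × ℝ) : ℝ :=
  ∑ m ∈ Finset.range (n + 1), ∑ m' ∈ Finset.range (n + 1),
    if m < m' then interlayerSum a (z m' - z m) (c m' - c m) else 0

/-- `d`-REGISTERED LAMINAR-GOOD SITE: a registry-blind (`κ = 1`) template matches the `R`-ball around `x i` two-way
with tolerance `η`, AND its interfaces between layers of height `|z m| ≤ 4` (those meeting the `2`-ball around the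
centre, with margin) are `d`-close to hollow registry. -/
def RegGoodNear (d R η : ℝ) {N : ℕ} (x : Fin N → E3) (i : Fin N) : Prop :=
  ∃ a : ℝ, 47 / 50 ≤ a ∧ a ≤ 1 ∧ ∃ (A : E3 →ₗᵢ[ℝ] E3) (s : ℤ → ℤ) (z : ℤ → ℝ) (o : ℤ → ℝ × ℝ), IsHaggSeq s ∧
    (∀ m : ℤ, 39 / 50 * a ≤ z (m + 1) - z m ∧ z (m + 1) - z m ≤ 17 / 20 * a) ∧
    (∀ m : ℤ, |(o m).1| ≤ 1 ∧ |(o m).2| ≤ 1) ∧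
    (∀ m : ℤ, |z m| ≤ 4 → misreg s o (m - 1) ≤ d ∧ misreg s o m ≤ d) ∧
    let S : Set E3 := {p | ∃ m k l : ℤ, p = A (((k : ℝ) • triangularVec₁ a) + ((l : ℝ) • triangularVec₂ a) +
      ((haggLabel s m : ℝ) • barlowOffset a) + (((o m).1 • triangularVec₁ a) + ((o m).2 • triangularVec₂ a)) +
      (z m • layerNormal 1))}
    (∀ p ∈ S, ‖p‖ ≤ R → ∃ j : Fin N, dist (x j - x i) p ≤ η) ∧
    (∀ j : Fin N, ‖x j - x i‖ ≤ R → ∃ p ∈ S, dist (x j - x i) p ≤ η)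

/-- `RegGoodNear` is antitone in the radius and monotone in the tolerance. [folklore] -/
theorem regGoodNear_mono {d R R' η η' : ℝ} (hR : R ≤ R') (hη : η' ≤ η) {N : ℕ} (x : Fin N → E3) (i : Fin N) :
    RegGoodNear d R' η' x i → RegGoodNear d R η x i := by
  rintro ⟨a, ha₁, ha₂, A, s, z, o, hs, hz, ho, hreg, h₁, h₂⟩
  refine ⟨a, ha₁, ha₂, A, s, z, o, hs, hz, ho, hreg, ?_, ?_⟩
  · intro p hp hpR
    obtain ⟨j, hj⟩ := h₁ p hp (hpR.trans hR)
    exact ⟨j, hj.trans hη⟩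
  · intro j hj
    obtain ⟨p, hp, hjp⟩ := h₂ j (hj.trans hR)
    exact ⟨p, hp, hjp.trans hη⟩

/-! ### The registry gap as a named proposition (Stub 2 takes it as hypothesis) -/

/-- Statement of `stub_registryGap` (verbatim; see there). [conjecture] -/
def Sig.stub_registryGap : Prop :=
    ∃ κ₀ : ℝ, 0 < κ₀ ∧ ∀ a : ℝ, 47 / 50 ≤ a → a ≤ 1 → ∀ (n : ℕ) (z : ℕ → ℝ) (c : ℕ → ℝ × ℝ),
      (∀ m : ℕ, 39 / 50 * a ≤ z (m + 1) - z m ∧ z (m + 1) - z m ≤ 17 / 20 * a) →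
      ∃ c' : ℕ → ℝ × ℝ, (∀ m : ℕ, hollowDist (c' (m + 1) - c' m) = 0) ∧
        stackEnergy a n z c' + κ₀ * ∑ m ∈ Finset.range n, hollowDist (c (m + 1) - c m) ^ 2 ≤
          stackEnergy a n z c

/-! ### The declared stubs (the only `sorry`s of the file) -/

/-- **Stub 1 — registry gap of the Lennard-Jones interlayer lattice sums (THE NEW INPUT; load-bearing;
configuration-free).**  There is `κ₀ > 0` such that for every spacing `a ∈ [47/50, 1]`, every finite stack of
`n+1` triangular layers with consecutive heights in the box `[39a/50, 17a/20]` and ARBITRARY lateral positions `c`,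
some Barlow-registered lateral sequence `c'` (every relative shift in the hollow set) at the SAME heights satisfies
`stackEnergy a n z c' + κ₀ · Σ_{m<n} hollowDist(c (m+1) − c m)² ≤ stackEnergy a n z c`.  Intended proof: the
adjacent-layer coupling `Φ_h = interlayerSum a h` (`h ∈ [0.733, 0.85]`) is uniquely minimised over `ℝ²/Λ` at the two
hollow classes, with `Φ_h(c) − Φ_h(hollow) ≥ κ₁·hollowDist(c)²`, `κ₁ ≥ 0.15` (curvature `≥ 1.4`, bridge gap
`≥ 0.017`, on-top gap `≥ 0.28`; hand numerics, worst corner `a = 1`, `h = 0.85`); every farther coupling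
`Φ_H`, `H ≥ 1.466`, has all lattice and hollow vectors as critical points (3-fold symmetry) and `‖Hess Φ_H‖ ≤ 4·10⁻³`
(`H = 2h`), `≤ 10⁻⁶` beyond (Poisson summation: the registry-dependent part of a planar lattice sum at height `H`
is `O(e^{−4πH/(a√3)})` with all derivatives), so with `c'` := interface-wise nearest hollow shifts,
`|Φ_H(Σe) − Φ_H(0)| ≤ ½‖Hess‖·k·Σ|e_i|²` is absorbed: `κ₀ ≥ κ₁ − Σ_k k²·‖Hess Φ_{H_k}‖ > 0` (margin ≈ 6 at the worst
corner).  May fail only through a numerical slip in the worst corner of the box (`a = 1`, `h/a = 0.85`, where the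
bridge gap `0.017` is smallest) — a certified interval evaluation of four lattice sums settles it. [conjecture] -/
theorem stub_registryGap :
    ∃ κ₀ : ℝ, 0 < κ₀ ∧ ∀ a : ℝ, 47 / 50 ≤ a → a ≤ 1 → ∀ (n : ℕ) (z : ℕ → ℝ) (c : ℕ → ℝ × ℝ),
      (∀ m : ℕ, 39 / 50 * a ≤ z (m + 1) - z m ∧ z (m + 1) - z m ≤ 17 / 20 * a) →
      ∃ c' : ℕ → ℝ × ℝ, (∀ m : ℕ, hollowDist (c' (m + 1) - c' m) = 0) ∧
        stackEnergy a n z c' + κ₀ * ∑ m ∈ Finset.range n, hollowDist (c (m + 1) - c m) ^ 2 ≤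
          stackEnergy a n z c := by
  sorry

/-- **Stub 2 — misregistry is sparse along ground states (Lennard-Jones block accounting; load-bearing).**
Given the registry gap: under FLOOR(P₀) and the registry-blind budget, along every Lennard-Jones ground-state
sequence, for every `d, θ > 0` there is a scale `(R₀, η₀)` beyond which, eventually in `N`, at most `θN` sites fail
to be `d`-registered laminar-good.  Intended proof: `e(P₀) = e*` (`floor_iff_eq_eStar`) and `E(x_N) ≤ N·e* + o(N)`
(`crysEnergyLimit`); the sites that are not laminar-good at scale `(R₀,η₀)` are `o(N)` by the budget; tile space
into cubes of side `B`; a cube containing a laminar-good site (`R₀ ≥ 4B`) is two-way matched to ONE laminar template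
`T`, and `Σ_{j∈cube} ½·siteE_j ≥ Σ_layers n_m·ε_m(T) − #cube·ω(η₀, R₀)` with `ε_m(T) = ½(e_2D(a) + Σ_{m'≠m}
interlayerSum a (z_{m'}−z_m) (c_{m'}−c_m))` EXACT for template positions (site energies see all partners; tail and
tolerance errors `ω → 0`); by Stub 1 and PERIODISATION of the registered comparison stack (any window of an
admissible registered stack, closed up periodically with a screw period, is a periodic configuration, so its layer
energies sum to `≥ n·e* − C₁`, `card_mul_eStar_le`/definition of `e*`, seam error `Σ_{i<0<j}(j−i)^{-4} < ∞`),
`Σ_m n_m ε_m(T) ≥ #cube·e* + κ₀·n̄·Σ_{interfaces} hollowDist² − C·B²`; cubes without a good site hold only budgeted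
sites with `½·siteE ≥ −C₀` (`δ`-separation); summing, `κ₀ n̄ ΣΣ hollowDist² ≤ o(N) + N·(ω + C/B) + C·#budgeted`, so
the sites of good cubes adjacent to a `d`-misregistered interface are `≤ θN` for `B`, `R₀`, `1/η₀` large; such a
site recentred (`RegGood 1` is closed under recentring at a matched particle: absorb the integer part of the lateral
translation into `(k,l)`, keep `|o|_∞ ≤ 1/2`) is `d`-registered laminar-good at scale `(R₀ − 4B, η₀)`.  May fail if
the periodisation constant `C₁` could grow with the window (it cannot: interlayer couplings decay like `H⁻⁴`), or
through bookkeeping of the `n_m = B²/|cell| ± O(B)` layer populations. [conjecture] -/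
theorem stub_misregistrySparse : Sig.stub_registryGap →
    ∀ P₀ : PeriodicConfiguration 3, Floor P₀ → RegBudget 1 P₀ →
      ∀ x : (N : ℕ) → (Fin N → E3), (∀ N, IsGroundState lennardJones (x N)) →
        ∀ d θ : ℝ, 0 < d → 0 < θ → ∃ R₀ η₀ : ℝ, 0 < R₀ ∧ 0 < η₀ ∧ ∀ R η : ℝ, R₀ ≤ R → 0 < η → η ≤ η₀ →
          ∀ᶠ N in atTop, (Nat.card {i : Fin N // ¬ RegGoodNear d R η (x N) i} : ℝ) ≤ θ * N := by
  sorry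

/-- **Stub 3 — Barlow rounding (potential-free geometry).**  For every `η > 0` there are `d, η₁ > 0` and a radius
`R₁` such that a `d`-registered laminar-good site at scale `(R₁, η₁)` is two-way `(2, η)`-layered-good for a genuine
Barlow template.  Intended proof: take the laminar template `(a, A, s, z, o)`; the centre `0 = x i − x i` is
`η₁`-close to a template point, so some layer `m₀` has `|z m₀| ≤ η₁` and absolute lateral coefficient in `ℤ² +
O(η₁)`; the layers meeting the `2`-ball have `|z m| ≤ 2 + η < 4`, so each of the `≤ 4` interfaces between them is
`d`-close to a hollow class — choose the new Hägg sign `s' m = ±1` by the nearest class, re-index `m ↦ m − m₀`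
(`haggLabel s' 0 = 0`, heights `z' m = z (m + m₀)`, same `A`, same `a`); the Barlow template's points of norm `≤ 3`
are then within `(η₁ + 4d)·(3/2)` of laminar template points and conversely (integer re-indexing of `(k, l)`), so
both matching clauses transfer with tolerance `η₁ + 2(η₁ + 4d) ≤ η`.  May fail only through tolerance bookkeeping
(sup-metric coefficients versus Euclidean lengths: factor `≤ a·(1 + 1/2 + √3/2) < 2.4`). [folklore] -/
theorem stub_barlowRounding :
    ∀ η : ℝ, 0 < η → ∃ d η₁ R₁ : ℝ, 0 < d ∧ 0 < η₁ ∧ 0 < R₁ ∧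
      ∀ (N : ℕ) (x : Fin N → E3) (i : Fin N), RegGoodNear d R₁ η₁ x i → LayeredGood 2 η x i := by
  sorry

/-! ### The remaining stub statements as named propositions (verbatim) -/

/-- Statement of `stub_misregistrySparse` (verbatim). [conjecture] -/
def Sig.stub_misregistrySparse : Prop := Sig.stub_registryGap →
    ∀ P₀ : PeriodicConfiguration 3, Floor P₀ → RegBudget 1 P₀ →
      ∀ x : (N : ℕ) → (Fin N → E3), (∀ N, IsGroundState lennardJones (x N)) →
        ∀ d θ : ℝ, 0 < d → 0 < θ → ∃ R₀ η₀ : ℝ, 0 < R₀ ∧ 0 < η₀ ∧ ∀ R η : ℝ, R₀ ≤ R → 0 < η → η ≤ η₀ →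
          ∀ᶠ N in atTop, (Nat.card {i : Fin N // ¬ RegGoodNear d R η (x N) i} : ℝ) ≤ θ * N

/-- Statement of `stub_barlowRounding` (verbatim). [folklore] -/
def Sig.stub_barlowRounding : Prop :=
    ∀ η : ℝ, 0 < η → ∃ d η₁ R₁ : ℝ, 0 < d ∧ 0 < η₁ ∧ 0 < R₁ ∧
      ∀ (N : ℕ) (x : Fin N → E3) (i : Fin N), RegGoodNear d R₁ η₁ x i → LayeredGood 2 η x i

/-! ### Sorry-free glue -/

/-- **Stubs 2 + 3 ⇒ the radius-`2` Barlow defects are sparse** along the sequence: for every tolerance `η` and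
density `θ > 0`, eventually at most `θN` sites are not two-way `(2, η)`-layered-good. [folklore] -/
theorem sparse_bad_two (h₁ : Sig.stub_registryGap) (h₂ : Sig.stub_misregistrySparse) (h₃ : Sig.stub_barlowRounding)
    (P₀ : PeriodicConfiguration 3) (hF : Floor P₀) (hB : RegBudget 1 P₀)
    (x : (N : ℕ) → (Fin N → E3)) (hx : ∀ N, IsGroundState lennardJones (x N)) :
    ∀ η θ : ℝ, 0 < η → 0 < θ →
      ∀ᶠ N in atTop, (Nat.card {i : Fin N // ¬ LayeredGood 2 η (x N) i} : ℝ) ≤ θ * N := by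
  intro η θ hη hθ
  obtain ⟨d, η₁, R₁, hd, hη₁, hR₁, hround⟩ := h₃ η hη
  obtain ⟨R₀, η₀, hR₀, hη₀, hsparse⟩ := h₂ h₁ P₀ hF hB x hx d θ hd hθ
  have hev := hsparse (max R₀ R₁) (min η₀ η₁) (le_max_left _ _) (lt_min hη₀ hη₁) (min_le_left _ _)
  refine hev.mono fun N hN => le_trans ?_ hN
  have hle : Nat.card {i : Fin N // ¬ LayeredGood 2 η (x N) i} ≤
      Nat.card {i : Fin N // ¬ RegGoodNear d (max R₀ R₁) (min η₀ η₁) (x N) i} := by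
    rw [Nat.card_eq_fintype_card, Nat.card_eq_fintype_card]
    exact Fintype.card_subtype_mono _ _ fun i hi hg =>
      hi (hround N (x N) i (regGoodNear_mono (le_max_right _ _) (min_le_right _ _) (x N) i hg))
  exact_mod_cast hle

/-- **Sparse radius-`2` defects ⇒ good sites at every scale, frequently** (landed chart gluing
`FluxCellKeplerSingleScale.card_bad_le` at `R₀ = 2`, `δ`-separation of ground states
`LennardJonesMinimalDistance_holds`, and counting). [folklore] -/
theorem good_of_sparse (x : (N : ℕ) → (Fin N → E3)) (hx : ∀ N, IsGroundState lennardJones (x N))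
    (hsp : ∀ η θ : ℝ, 0 < η → 0 < θ →
      ∀ᶠ N in atTop, (Nat.card {i : Fin N // ¬ LayeredGood 2 η (x N) i} : ℝ) ≤ θ * N) :
    ∀ R η : ℝ, 0 < R → 0 < η → ∃ᶠ N in atTop, ∃ i : Fin N, LayeredGood R η (x N) i := by
  intro R η hR hη
  obtain ⟨δ, hδ, hsep⟩ := LennardJonesMinimalDistance_holds
  obtain ⟨η', hη', M, hM, hcard⟩ := card_bad_le (le_refl (2 : ℝ)) hδ R η hη
  have hθ : (0 : ℝ) < 1 / (2 * M) := by positivity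
  have hev := (hsp η' (1 / (2 * M)) hη' hθ).and (eventually_ge_atTop 1)
  refine hev.frequently.mono fun N hN => ?_
  obtain ⟨hNsp, hN1⟩ := hN
  by_contra hno
  have hno' : ∀ i : Fin N, ¬ LayeredGood R η (x N) i := fun i hi => hno ⟨i, hi⟩
  have hall : (N : ℝ) ≤ Nat.card {i : Fin N // ¬ LayeredGood R η (x N) i} := by
    rw [Nat.card_eq_fintype_card, Fintype.card_subtype]
    have : (Finset.univ.filter fun i : Fin N => ¬ LayeredGood R η (x N) i) = Finset.univ :=
      Finset.filter_true_of_mem fun i _ => hno' i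
    rw [this, Finset.card_univ, Fintype.card_fin]
  have h1 := hcard N (x N) (hsep N (x N) (hx N))
  have hN1' : (1 : ℝ) ≤ N := by exact_mod_cast hN1
  have hchain : (N : ℝ) ≤ M * (1 / (2 * M) * N) := hall.trans (h1.trans (mul_le_mul_of_nonneg_left hNsp hM.le))
  have hMM : M * (1 / (2 * M) * N) = N / 2 := by field_simp
  rw [hMM] at hchain
  linarith

open Summit.AtomisticToContinuum.Crystallization.Theorems.FluxTubeKeplerFloorGivesLayered
  (spacing_selection match_dilate layered_pt_scale) in
/-- (Verbatim from the sibling lines `Lines/PosTolRung.lean` (ToleranceLadder) and `Lines/VacancyBlindRung.lean`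
(VacancyLadder).)  Steps 2–3 of the seed, isolated: good sites at every scale (with scale-dependent spacings) give
the layered-windows hypothesis of `FluxTubeKepler.PeriodicGivenLayered` (one spacing by `spacing_selection`,
transfer by dilation `match_dilate` + `layered_pt_scale`, translation `t := −x N i`). [folklore] -/
theorem hasLayeredWindows_of_good (x : (N : ℕ) → (Fin N → E3))
    (hgood : ∀ R η : ℝ, 0 < R → 0 < η → ∃ᶠ N in atTop, ∃ i : Fin N, LayeredGood R η (x N) i) :
    ∃ a : ℝ, 47 / 50 ≤ a ∧ a ≤ 1 ∧ ∀ R ε : ℝ, 0 < ε → ∃ᶠ N in Filter.atTop,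
      ∃ (A : E3 →ₗᵢ[ℝ] E3) (t : E3) (s : ℤ → ℤ) (z : ℤ → ℝ), IsHaggSeq s ∧
      (∀ m : ℤ, 39 / 50 * a ≤ z (m + 1) - z m ∧ z (m + 1) - z m ≤ 17 / 20 * a) ∧
      let S : Set E3 := {p | ∃ m i j : ℤ, p = A (((i : ℝ) • triangularVec₁ a) +
        ((j : ℝ) • triangularVec₂ a) + ((haggLabel s m : ℝ) • barlowOffset a) + (z m • layerNormal 1))};
      (∀ p ∈ S, ‖p‖ ≤ R → ∃ i : Fin N, dist (x N i + t) p ≤ ε) ∧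
      (∀ i : Fin N, ‖x N i + t‖ ≤ R → ∃ p ∈ S, dist (x N i + t) p ≤ ε) := by
  -- Step 2: one spacing for all scales, the transfer being dilation of the whole layered datum
  have hgood' : ∀ R η : ℝ, 0 < R → 0 < η → ∃ᶠ N in atTop, ∃ i : Fin N, ∃ a : ℝ, 47 / 50 ≤ a ∧ a ≤ 1 ∧
      ∃ (A : E3 →ₗᵢ[ℝ] E3) (s : ℤ → ℤ) (z : ℤ → ℝ), IsHaggSeq s ∧
        (∀ m : ℤ, 39 / 50 * a ≤ z (m + 1) - z m ∧ z (m + 1) - z m ≤ 17 / 20 * a) ∧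
        let S : Set E3 := {p | ∃ m k l : ℤ, p = A (((k : ℝ) • triangularVec₁ a) +
          ((l : ℝ) • triangularVec₂ a) + ((haggLabel s m : ℝ) • barlowOffset a) + (z m • layerNormal 1))};
        (∀ p ∈ S, ‖p‖ ≤ R → ∃ j : Fin N, dist (x N j - x N i) p ≤ η) ∧
        (∀ j : Fin N, ‖x N j - x N i‖ ≤ R → ∃ p ∈ S, dist (x N j - x N i) p ≤ η) := hgood
  obtain ⟨a, ha1, ha2, hwin⟩ := spacing_selection hgood' fun R ε hR hε => by
    obtain ⟨η₁, hη₁0, hη₁ε, hη₁1⟩ : ∃ η₁ : ℝ, 0 < η₁ ∧ η₁ ≤ ε ∧ η₁ ≤ 1 :=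
      ⟨min ε 1, lt_min hε one_pos, min_le_left _ _, min_le_right _ _⟩
    have hR1 : 0 < R + 1 := by linarith
    obtain ⟨θ, hθ0, hθR⟩ : ∃ θ : ℝ, 0 < θ ∧ θ * (R + 1) = η₁ / 2 :=
      ⟨η₁ / 2 / (R + 1), by positivity, by field_simp⟩
    refine ⟨47 / 50 * θ, by positivity, R + 1, η₁ / 2, by positivity, ?_⟩
    intro a b R' η' ha hb hab hRR' hη' N i hG
    obtain ⟨A, s, z, hs, hbox, hM₁, hM₂⟩ := hG
    have ha0 : 0 < a := by linarith
    have hb0 : 0 < b := by linarith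
    obtain ⟨ρ, hρ0, hρb⟩ : ∃ ρ : ℝ, 0 < ρ ∧ ρ * b = a :=
      ⟨a / b, div_pos ha0 hb0, div_mul_cancel₀ a hb0.ne'⟩
    have habs : |b - a| < 47 / 50 * θ := hab
    have h1ρ : |1 - ρ| ≤ θ := by
      have e1 : 1 - ρ = (b - a) / b := by rw [← hρb]; field_simp
      rw [e1, abs_div, abs_of_pos hb0, div_le_iff₀ hb0]
      nlinarith [abs_nonneg (b - a)]
    have h1ρ' : |ρ⁻¹ - 1| ≤ θ := by
      have e1 : ρ⁻¹ - 1 = (b - a) / a := by rw [← hρb]; field_simp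
      rw [e1, abs_div, abs_of_pos ha0, div_le_iff₀ ha0]
      nlinarith [abs_nonneg (b - a)]
    refine ⟨A, s, fun m => ρ * z m, hs, fun m => ?_, ?_⟩
    · obtain ⟨hl, hu⟩ := hbox m
      have hl' := mul_le_mul_of_nonneg_left hl hρ0.le
      have hu' := mul_le_mul_of_nonneg_left hu hρ0.le
      constructor
      · calc 39 / 50 * a = ρ * (39 / 50 * b) := by rw [← hρb]; ring
          _ ≤ ρ * (z (m + 1) - z m) := hl'
          _ = ρ * z (m + 1) - ρ * z m := by ring
      · calc ρ * z (m + 1) - ρ * z m = ρ * (z (m + 1) - z m) := by ring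
          _ ≤ ρ * (17 / 20 * b) := hu'
          _ = 17 / 20 * a := by rw [← hρb]; ring
    · have hscale : ∀ m k l : ℤ, A (((k : ℝ) • triangularVec₁ a) + ((l : ℝ) • triangularVec₂ a) +
          ((haggLabel s m : ℝ) • barlowOffset a) + ((ρ * z m) • layerNormal 1)) =
          ρ • A (((k : ℝ) • triangularVec₁ b) + ((l : ℝ) • triangularVec₂ b) +
          ((haggLabel s m : ℝ) • barlowOffset b) + (z m • layerNormal 1)) := by
        intro m k l
        rw [← hρb]
        exact layered_pt_scale A ρ b s z m k l
      dsimp only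
      refine match_dilate (fun j => x N j - x N i) _ _ hθ0 hθR hη₁ε hη₁1 hρ0 h1ρ h1ρ' hRR' hη'
        ?_ ?_ hM₁ hM₂
      · rintro p ⟨m, k, l, rfl⟩
        exact ⟨m, k, l, (hscale m k l).symm⟩
      · rintro p' ⟨m, k, l, rfl⟩
        exact ⟨_, ⟨m, k, l, rfl⟩, hscale m k l⟩
  -- Step 3: read the fixed-spacing good site at radius `max R 1` and translate by `t := -x N i`
  refine ⟨a, ha1, ha2, fun R ε hε => ?_⟩
  have hR' : 0 < max R 1 := lt_max_of_lt_right one_pos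
  refine (hwin (max R 1) ε hR' hε).mono fun N hN => ?_
  obtain ⟨i, hi⟩ := hN
  obtain ⟨A, s, z, hs, hbox, hM₁, hM₂⟩ := hi
  refine ⟨A, -x N i, s, z, hs, hbox, ?_⟩
  have hsub : ∀ j : Fin N, x N j + -x N i = x N j - x N i := fun j =>
    (sub_eq_add_neg (x N j) (x N i)).symm
  intro S
  refine ⟨fun p hp hpR => ?_, fun j hj => ?_⟩
  · obtain ⟨j, hj⟩ := hM₁ p hp (hpR.trans (le_max_left R 1))
    exact ⟨j, by rw [hsub j]; exact hj⟩
  · rw [hsub j] at hj ⊢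
    exact hM₂ j (hj.trans (le_max_left R 1))

/-! ### The skeleton theorem: the rung BY NAME from the three stub statements (sorry-free) -/

/-- **Assembly.** `stub_registryGap → stub_misregistrySparse → stub_barlowRounding → RegistryBlindRung`: under
FLOOR and the registry-blind budget, stubs 1+2+3 make the radius-`2` Barlow defects sparse along the sequence
(`sparse_bad_two`); the landed chart gluing turns sparsity into good sites at every scale (`good_of_sparse`), hence
layered windows (`hasLayeredWindows_of_good`) and periodic windows (proved `PeriodicGivenLayered`). -/
theorem RegistryBlindRung_of (h₁ : Sig.stub_registryGap) (h₂ : Sig.stub_misregistrySparse)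
    (h₃ : Sig.stub_barlowRounding) : RegistryBlindRung := by
  intro P₀ hF hB x hx
  have hgood := good_of_sparse x hx (sparse_bad_two h₁ h₂ h₃ P₀ hF hB x hx)
  exact Theses.FluxTubeKepler.PeriodicGivenLayered_holds x hx (hasLayeredWindows_of_good x hgood)

/-- **The closed skeleton instance**: the rung by name from the three declared stubs (the only `sorry`s of this
file enter here). [conjecture] -/
theorem RegistryBlindRung_skeleton : RegistryBlindRung :=
  RegistryBlindRung_of stub_registryGap stub_misregistrySparse stub_barlowRounding

end Summit.AtomisticToContinuum.Crystallization.Cruxes.FluxCellKepler.RegistryLadder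

end
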